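/- EXTRA WIDTH seat `ym-line-cbag-p1-w5` (prover-ym-line-cbag-p1-w5-g17-0), LINE 7b `VolumeComparison` of route `GlueballBandRecursion`,
item ⟨stmt-QuantumFields-22957⟩ (`--supports`, helper; it closes nothing).  Piece C3 (support lifting across spatial volumes), rotation
half: the support sums `ψ(A)` of the cluster expansion regrouped by support are transported along local isomorphisms of plaquette systems
(hence invariant under the translations of a periodic box), and a translation-invariant family of ROOTABLE supports sums to `nᵢ` times —
over several directions `∏ nᵢ` times — its rooted part.  The support-level twin of `PeriodicBoxRooting.sum_small_eq_size_mul_sum_boxRooted`,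
keyed on an abstract rooting hypothesis (discharged for closed connected supports by `SlabCount.exists_rooting_of_closed`) instead of the
total size.  Definition-free; route-independent. -/
import Summits.QuantumFields.YangMills.Theorems.GlueballBandRecursionSupportExpansion
import Literature.MathematicalPhysics.QuantumFieldTheory.PeriodicBoxFreeEnergy

/-!
# Route `GlueballBandRecursion`, LINE 7b: support sums under local isomorphisms and translations; the factor of the volume

Notation (always written out, as in `…SupportExpansion`): for a plaquette system `S : PlaqSystem d G ι` on `ν = zdHaar d G` and a finite label
set `A`, the SUPPORT SUM `ψ_S(A)(z) := Σ_{𝒞 ⊆ 𝒫_S(A), ⋃𝒞 = A} Φ^T_S(𝒞)(z)` (families of `S.Adj`-connected subsets of `A` with union `A`,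
truncated functional of the Kotecký–Preiss expansion at complex coupling `z`), so that `log Z(W) = Σ_{A ⊆ W} ψ(A)`
(`Support.pertLogZ_eq_sum_support`).

* §1 `filter_support_image_eq`, **`support_sum_image_eq_of_localIso`** — along a local isomorphism `φ` of plaquette systems on a label set
  `A₀` (hypotheses `h1`–`h4` of `PlaqSystemLocalIso`: bonds relabelled by an injective `g`, costs read through `g`, `φ` injective on `A₀`),
  the families of polymers with support `φ '' A` (`A ⊆ A₀`) are exactly the images of the families with support `A`, and
  `ψ_{S'}(φ '' A)(z) = ψ_S(A)(z)` for EVERY `z` (an identity of finite sums; no smallness).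
* §2 **`support_sum_image_rot_eq`** — on the periodic box `boxSystem ρ n` the support sum is invariant under the translations
  `BoxLabel.rot i s` (global symmetries: `bonds_rot`, `injOn_boxEdgeRot`, `cost_rot`, `rot_injective` of `PeriodicBoxRotation`);
  `image_rot_image_rot`, `image_rot_size`, `image_rot_add_size`, `rooted_image_rot_iff_of_ne` (bookkeeping of the action on label SETS).
* §3 **`sum_support_eq_size_mul_sum_rooted`** — THE FACTOR `nᵢ`: for any property `Q` of label sets invariant under the translations in
  direction `i`, such that every `Q`-set can be ROOTED at scale `m` by such a translation (all `i`-coordinates `< m`, some `= 0`) and a rooted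
  `Q`-set is rooted again only by the trivial translation (free action), `Σ_{Q} ψ = nᵢ · Σ_{Q ∧ rooted_i} ψ` — the bijection
  `Fin nᵢ × {rooted Q-sets} → {Q-sets}`, `(s, A) ↦ rot i s '' A`, with equal support sums (§2).
* §4 **`sum_support_eq_prod_mul_sum_of_iff`** — iterating over a set `J` of directions: `Σ_{Q} ψ = (∏_{i∈J} nᵢ) · Σ_{Q'} ψ` for any `Q'`
  equivalent to «`Q` and rooted in every `j ∈ J`» (robust to the spelling of `Q'` and to decidability instances).

Use (LINE 7b, piece C3; LEAD ym-line-cbag-p1 g29's jet stub `Thermal.ThermalFreeEnergyVolumeJets` / `ColdFreeEnergyVolumeJets`): with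
`n = ![b,b,b,T]`, `J = {0,1,2}`, `Q` = the kept family «`#A = 1` or (closed, connected, `#A ≤ 4(a−1)`)» (rooting: w2's
`SlabCount.exists_rooting_of_closed`; free action: uniqueness of the rooting of a connected set), the kept part of `log Z(b³×T)` is `b³ ×` a
rooted sum, and the rooted sums of the boxes `a³×T ⊆ a'³×T` agree (w3's `BoxSupport.sum_support_sum_eq_of_le`): the per-site kept free energy
is the same in both volumes, exactly, for every complex coupling — the equality half of the volume comparison (sequel file).

HONEST FRAMING.  Finite combinatorics on top of the tree's Kotecký–Preiss layer; nothing here proves the volume comparison, item 22957, the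
RECORD rung `ColdDoublingRecursionStrongCoupling`, or the Yang–Mills mass gap / the summit `YangMills`.
-/

set_option autoImplicit false

noncomputable section

open MeasureTheory Finset
open Literature.Probability.LatticeModels
open Literature.MathematicalPhysics.QuantumFieldTheory

namespace Summit.QuantumFields.YangMills.Theorems.GlueballBandRecursion.SupportLifting

/-! ## §1 Support sums along a local isomorphism of plaquette systems -/

section LocalIso

variable {d : ℕ} {G : Type*} [Group G] [TopologicalSpace G] [IsTopologicalGroup G] [CompactSpace G]
  [MeasurableSpace G] [BorelSpace G] {ι ι' : Type*} [DecidableEq ι] [DecidableEq ι']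
  {S : PlaqSystem d G ι} {S' : PlaqSystem d G ι'} {M : ℝ} {D : ℕ}
  {φ : ι → ι'} {g : ZdEdge d → ZdEdge d} {A₀ : Finset ι}

omit [DecidableEq ι] in
/-- The preimage inside `A` of a subset `Y'` of `φ '' A`, pushed forward again, is `Y'`. -/
theorem image_filter_mem_eq {A : Finset ι} {Y' : Finset ι'} (hY' : Y' ⊆ A.image φ) :
    (A.filter fun p => φ p ∈ Y').image φ = Y' := by
  ext y
  simp only [Finset.mem_image, Finset.mem_filter]
  constructor
  · rintro ⟨p, ⟨-, hp⟩, rfl⟩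
    exact hp
  · intro hy
    obtain ⟨p, hpA, rfl⟩ := Finset.mem_image.1 (hY' hy)
    exact ⟨p, ⟨hpA, hy⟩, rfl⟩

omit [Group G] [TopologicalSpace G] [IsTopologicalGroup G] [CompactSpace G] [MeasurableSpace G] [BorelSpace G] in
/-- **The families of polymers with support `φ '' A` are the images of the families of polymers with support `A`** along a local
isomorphism on `A₀ ⊇ A` (bonds relabelled by `g` injective on the bonds of `A₀`, `φ` injective on `A₀`). -/
theorem filter_support_image_eq (h1 : ∀ p ∈ A₀, S'.bonds (φ p) = (S.bonds p).image g)
    (h2 : Set.InjOn g (↑(A₀.biUnion S.bonds) : Set (ZdEdge d))) (h4 : Set.InjOn φ A₀) {A : Finset ι} (hA : A ⊆ A₀) :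
    ((rconnSubsets S'.Adj (A.image φ)).powerset.filter fun 𝒞' => 𝒞'.biUnion id = A.image φ) =
      ((rconnSubsets S.Adj A).powerset.filter fun 𝒞 => 𝒞.biUnion id = A).image
        fun 𝒞 => 𝒞.image (Finset.image φ) := by
  ext 𝒞'
  simp only [Finset.mem_filter, Finset.mem_powerset, Finset.mem_image]
  constructor
  · rintro ⟨h𝒞'sub, h𝒞'U⟩
    refine ⟨𝒞'.image fun Y' => A.filter fun p => φ p ∈ Y', ⟨?_, ?_⟩, ?_⟩
    · -- the preimages are polymers of `A`
      intro Y hY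
      obtain ⟨Y', hY', rfl⟩ := Finset.mem_image.1 hY
      have hY'mem := mem_rconnSubsets.1 (h𝒞'sub hY')
      refine mem_rconnSubsets.2 ⟨Finset.filter_subset _ _, ?_⟩
      have hsub : (A.filter fun p => φ p ∈ Y') ⊆ A₀ := (Finset.filter_subset _ _).trans hA
      rw [← PlaqSystem.isRConnected_image_iff h1 h2 h4 hsub, image_filter_mem_eq hY'mem.1]
      exact hY'mem.2
    · -- their union is `A`
      refine Finset.Subset.antisymm (Finset.biUnion_subset.2 fun Y hY => ?_) fun p hp => ?_
      · obtain ⟨Y', -, rfl⟩ := Finset.mem_image.1 hY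
        exact Finset.filter_subset _ _
      · have hφp : φ p ∈ 𝒞'.biUnion id := by
          rw [h𝒞'U]
          exact Finset.mem_image_of_mem φ hp
        obtain ⟨Y', hY', hpY'⟩ := Finset.mem_biUnion.1 hφp
        exact Finset.mem_biUnion.2 ⟨_, Finset.mem_image_of_mem _ hY', Finset.mem_filter.2 ⟨hp, hpY'⟩⟩
    · -- pushing forward again gives back `𝒞'`
      rw [Finset.image_image]
      conv_rhs => rw [← Finset.image_id (s := 𝒞')]
      refine Finset.image_congr fun Y' hY' => ?_
      simp only [Function.comp_apply, id]
      exact image_filter_mem_eq (mem_rconnSubsets.1 (h𝒞'sub (Finset.mem_coe.1 hY'))).1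
  · rintro ⟨𝒞, ⟨h𝒞sub, h𝒞U⟩, rfl⟩
    refine ⟨fun Y' hY' => ?_, ?_⟩
    · obtain ⟨Y, hY, rfl⟩ := Finset.mem_image.1 hY'
      have hYmem := mem_rconnSubsets.1 (h𝒞sub hY)
      exact mem_rconnSubsets.2 ⟨Finset.image_subset_image hYmem.1,
        (PlaqSystem.isRConnected_image_iff h1 h2 h4 (hYmem.1.trans hA)).2 hYmem.2⟩
    · rw [Finset.image_biUnion, ← h𝒞U, Finset.biUnion_image]
      simp only [id_eq]

/-- **Support sums are transported along local isomorphisms**: under the hypotheses `h1`–`h4` of `PlaqSystemLocalIso` on `A₀` (for a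
regular `S`), `ψ_{S'}(φ '' A)(z) = ψ_S(A)(z)` for every `A ⊆ A₀` and EVERY complex `z` — the families of polymers with support `φ '' A` are
the images of those with support `A` (`filter_support_image_eq`) and `Φ^T` is transported (`PlaqSystem.truncatedWeight_image_image_eq`). -/
theorem support_sum_image_eq_of_localIso (hR : S.Regular M D) (h1 : ∀ p ∈ A₀, S'.bonds (φ p) = (S.bonds p).image g)
    (h2 : Set.InjOn g (↑(A₀.biUnion S.bonds) : Set (ZdEdge d)))
    (h3 : ∀ p ∈ A₀, ∀ U : ZdGaugeConfig d G, S'.cost (φ p) U = S.cost p (U ∘ g)) (h4 : Set.InjOn φ A₀)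
    {A : Finset ι} (hA : A ⊆ A₀) (z : ℂ) :
    ∑ 𝒞' ∈ (rconnSubsets S'.Adj (A.image φ)).powerset with 𝒞'.biUnion id = A.image φ,
        truncatedWeight (GeomInc S'.Adj) (connActivity S'.Adj (zdHaar d G) (S'.weight z)) 𝒞' =
      ∑ 𝒞 ∈ (rconnSubsets S.Adj A).powerset with 𝒞.biUnion id = A,
        truncatedWeight (GeomInc S.Adj) (connActivity S.Adj (zdHaar d G) (S.weight z)) 𝒞 := by
  rw [filter_support_image_eq h1 h2 h4 hA, Finset.sum_image]
  · refine Finset.sum_congr rfl fun 𝒞 h𝒞 => ?_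
    have hmem : ∀ Y ∈ 𝒞, Y ⊆ A₀ := fun Y hY =>
      (mem_rconnSubsets.1 (Finset.mem_powerset.1 (Finset.mem_filter.1 h𝒞).1 hY)).1.trans hA
    exact PlaqSystem.truncatedWeight_image_image_eq hR h1 h2 h3 h4 hmem z
  · refine injOn_image_of_injOn (R := A.powerset)
      (injOn_image_of_injOn (h4.mono (Finset.coe_subset.2 hA)) fun Y hY => Finset.mem_powerset.1 hY) fun 𝒞 h𝒞 Y hY => ?_
    exact Finset.mem_powerset.2 (mem_rconnSubsets.1 (Finset.mem_powerset.1 (Finset.mem_filter.1 h𝒞).1 hY)).1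

end LocalIso

/-! ## §2 Translations of the periodic box acting on label sets -/

section Rotation

variable {d : ℕ} {n : Fin d → ℕ}

/-- Composition of the translations on label sets. -/
theorem image_rot_image_rot (i : Fin d) (a b : ℕ) (A : Finset (BoxLabel n)) :
    (A.image (BoxLabel.rot i b)).image (BoxLabel.rot i a) = A.image (BoxLabel.rot i (a + b)) := by
  rw [Finset.image_image]
  exact Finset.image_congr fun p _ => BoxLabel.rot_rot i a b p

/-- Translation of label sets by the size is the identity. -/
@[simp] theorem image_rot_size (i : Fin d) (A : Finset (BoxLabel n)) : A.image (BoxLabel.rot i (n i)) = A := by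
  conv_rhs => rw [← Finset.image_id (s := A)]
  exact Finset.image_congr fun p _ => by simp

/-- Translation by `t + nᵢ` is translation by `t`. -/
theorem rot_add_size (i : Fin d) (t : ℕ) (p : BoxLabel n) : BoxLabel.rot i (t + n i) p = BoxLabel.rot i t p := by
  rw [← BoxLabel.rot_rot i t (n i) p, BoxLabel.rot_size]

/-- Translation of label sets by `t + nᵢ` is translation by `t`. -/
theorem image_rot_add_size (i : Fin d) (t : ℕ) (A : Finset (BoxLabel n)) :
    A.image (BoxLabel.rot i (t + n i)) = A.image (BoxLabel.rot i t) :=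
  Finset.image_congr fun p _ => rot_add_size i t p

/-- Undoing a translation: `rot i s ∘ rot i (nᵢ − s) = id` on label sets (`s ≤ nᵢ`). -/
theorem image_rot_image_rot_sub (i : Fin d) {s : ℕ} (hs : s ≤ n i) (A : Finset (BoxLabel n)) :
    (A.image (BoxLabel.rot i (n i - s))).image (BoxLabel.rot i s) = A := by
  rw [image_rot_image_rot, Nat.add_sub_cancel' hs, image_rot_size]

/-- The translations act injectively on label sets. -/
theorem image_rot_injective (i : Fin d) (s : ℕ) :
    Function.Injective fun A : Finset (BoxLabel n) => A.image (BoxLabel.rot i s) :=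
  Finset.image_injective (BoxLabel.rot_injective i s)

/-- **Rootedness in direction `j` is invariant under the translations in another direction `i`** (coordinates `j ≠ i` are unchanged). -/
theorem rooted_image_rot_iff_of_ne {i j : Fin d} (h : j ≠ i) (s m : ℕ) (A : Finset (BoxLabel n)) :
    ((∀ p ∈ A.image (BoxLabel.rot i s), BoxLabel.coord j p < m) ∧ ∃ p ∈ A.image (BoxLabel.rot i s), BoxLabel.coord j p = 0) ↔
      ((∀ p ∈ A, BoxLabel.coord j p < m) ∧ ∃ p ∈ A, BoxLabel.coord j p = 0) := by
  simp only [Finset.mem_image, forall_exists_index, and_imp, forall_apply_eq_imp_iff₂, BoxLabel.coord_rot_of_ne h,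
    exists_exists_and_eq_and]

/-- Rootedness of a translated set, read on the original labels. -/
theorem rooted_image_rot_iff (i : Fin d) (s m : ℕ) (A : Finset (BoxLabel n)) :
    ((∀ p ∈ A.image (BoxLabel.rot i s), BoxLabel.coord i p < m) ∧ ∃ p ∈ A.image (BoxLabel.rot i s), BoxLabel.coord i p = 0) ↔
      ((∀ p ∈ A, BoxLabel.coord i (BoxLabel.rot i s p) < m) ∧ ∃ p ∈ A, BoxLabel.coord i (BoxLabel.rot i s p) = 0) := by
  simp only [Finset.mem_image, forall_exists_index, and_imp, forall_apply_eq_imp_iff₂, exists_exists_and_eq_and]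

variable {G : Type*} [Group G] {N : ℕ} {ρ : G →* Matrix (Fin N) (Fin N) ℂ}
  [TopologicalSpace G] [IsTopologicalGroup G] [CompactSpace G] [MeasurableSpace G] [BorelSpace G]

/-- **The support sum is translation invariant** on the periodic box: `ψ(rot i s '' A)(z) = ψ(A)(z)` for the box plaquette system
`boxSystem ρ n`, every label set `A`, every translation and every complex `z` (the translations are global symmetries:
`BoxLabel.bonds_rot`, `injOn_boxEdgeRot`, `BoxLabel.cost_rot`, `BoxLabel.rot_injective`). -/
theorem support_sum_image_rot_eq (hρ : Continuous ρ) (i : Fin d) (s : ℕ) (A : Finset (BoxLabel n)) (z : ℂ) :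
    ∑ 𝒞' ∈ (rconnSubsets (boxSystem (G := G) ρ n).Adj (A.image (BoxLabel.rot i s))).powerset with
        𝒞'.biUnion id = A.image (BoxLabel.rot i s),
        truncatedWeight (GeomInc (boxSystem (G := G) ρ n).Adj)
          (connActivity (boxSystem (G := G) ρ n).Adj (zdHaar d G) ((boxSystem (G := G) ρ n).weight z)) 𝒞' =
      ∑ 𝒞 ∈ (rconnSubsets (boxSystem (G := G) ρ n).Adj A).powerset with 𝒞.biUnion id = A,
        truncatedWeight (GeomInc (boxSystem (G := G) ρ n).Adj)
          (connActivity (boxSystem (G := G) ρ n).Adj (zdHaar d G) ((boxSystem (G := G) ρ n).weight z)) 𝒞 :=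
  support_sum_image_eq_of_localIso (S := boxSystem (G := G) ρ n) (S' := boxSystem (G := G) ρ n) (A₀ := Finset.univ)
    (boxSystem_regular ρ hρ n) (fun p _ => BoxLabel.bonds_rot i s p) (injOn_boxEdgeRot i s _)
    (fun p _ U => BoxLabel.cost_rot ρ i s p U) (BoxLabel.rot_injective i s).injOn (Finset.subset_univ _) z

/-! ## §3 The factor `nᵢ`: translation-invariant families of rootable supports -/

/-- **The factor of the volume for support sums (one direction).**  Let `Q` be a property of label sets of the periodic box, invariant
under the translations in direction `i`; suppose every `Q`-set can be ROOTED at scale `m` in direction `i` by a translation (all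
`i`-coordinates `< m`, some equal to `0`; e.g. closed connected sets with `≤ 4m` members, `m < nᵢ`: `SlabCount.exists_rooting_of_closed`),
and that the translations act freely on rooted `Q`-sets (a rooted `Q`-set translated by `0 < s < nᵢ` is not rooted; e.g. connected sets,
`m < nᵢ`).  Then, for every complex coupling `z`,
`Σ_{A : Q A} ψ(A)(z) = nᵢ · Σ_{A : Q A, A rooted} ψ(A)(z)`:
the `Q`-sets are, bijectively, the `nᵢ` translates of the rooted ones, with equal support sums (`support_sum_image_rot_eq`). -/
theorem sum_support_eq_size_mul_sum_rooted (hρ : Continuous ρ) (i : Fin d) (m : ℕ)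
    (Q : Finset (BoxLabel n) → Prop) [DecidablePred Q]
    (hQ : ∀ (s : ℕ) (A : Finset (BoxLabel n)), Q (A.image (BoxLabel.rot i s)) ↔ Q A)
    (hex : ∀ A, Q A → ∃ s, s < n i ∧ (∀ p ∈ A, BoxLabel.coord i (BoxLabel.rot i (n i - s) p) < m) ∧
      ∃ p ∈ A, BoxLabel.coord i (BoxLabel.rot i (n i - s) p) = 0)
    (hfree : ∀ A, Q A → (∀ p ∈ A, BoxLabel.coord i p < m) → (∃ p ∈ A, BoxLabel.coord i p = 0) →
      ∀ s, s < n i → (∀ p ∈ A, BoxLabel.coord i (BoxLabel.rot i s p) < m) →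
        (∃ p ∈ A, BoxLabel.coord i (BoxLabel.rot i s p) = 0) → s = 0)
    (z : ℂ) :
    ∑ A ∈ (Finset.univ : Finset (BoxLabel n)).powerset with Q A,
        ∑ 𝒞 ∈ (rconnSubsets (boxSystem (G := G) ρ n).Adj A).powerset with 𝒞.biUnion id = A,
          truncatedWeight (GeomInc (boxSystem (G := G) ρ n).Adj)
            (connActivity (boxSystem (G := G) ρ n).Adj (zdHaar d G) ((boxSystem (G := G) ρ n).weight z)) 𝒞 =
      (n i : ℂ) * ∑ A ∈ (Finset.univ : Finset (BoxLabel n)).powerset with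
          (Q A ∧ (∀ p ∈ A, BoxLabel.coord i p < m) ∧ ∃ p ∈ A, BoxLabel.coord i p = 0),
        ∑ 𝒞 ∈ (rconnSubsets (boxSystem (G := G) ρ n).Adj A).powerset with 𝒞.biUnion id = A,
          truncatedWeight (GeomInc (boxSystem (G := G) ρ n).Adj)
            (connActivity (boxSystem (G := G) ρ n).Adj (zdHaar d G) ((boxSystem (G := G) ρ n).weight z)) 𝒞 := by
  classical
  set ψ : Finset (BoxLabel n) → ℂ := fun A =>
    ∑ 𝒞 ∈ (rconnSubsets (boxSystem (G := G) ρ n).Adj A).powerset with 𝒞.biUnion id = A,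
      truncatedWeight (GeomInc (boxSystem (G := G) ρ n).Adj)
        (connActivity (boxSystem (G := G) ρ n).Adj (zdHaar d G) ((boxSystem (G := G) ρ n).weight z)) 𝒞 with hψ
  set R : Finset (BoxLabel n) → Prop := fun A => (∀ p ∈ A, BoxLabel.coord i p < m) ∧ ∃ p ∈ A, BoxLabel.coord i p = 0 with hR
  set T := (Finset.univ : Finset (BoxLabel n)).powerset.filter Q with hT
  set Tr := (Finset.univ : Finset (BoxLabel n)).powerset.filter fun A => Q A ∧ R A with hTr
  set F : Fin (n i) × Finset (BoxLabel n) → Finset (BoxLabel n) := fun x => x.2.image (BoxLabel.rot i x.1) with hF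
  show ∑ A ∈ T, ψ A = (n i : ℂ) * ∑ A ∈ Tr, ψ A
  have hmemT : ∀ {A : Finset (BoxLabel n)}, A ∈ T ↔ Q A := by
    intro A
    simp only [hT, Finset.mem_filter, Finset.mem_powerset, Finset.subset_univ, true_and]
  have hmemTr : ∀ {A : Finset (BoxLabel n)}, A ∈ Tr ↔ Q A ∧ R A := by
    intro A
    simp only [hTr, Finset.mem_filter, Finset.mem_powerset, Finset.subset_univ, true_and]
  -- every `Q`-set is a translate of a rooted `Q`-set
  have himage : T = (Finset.univ ×ˢ Tr).image F := by
    ext A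
    constructor
    · intro hA
      have hQA := hmemT.1 hA
      obtain ⟨s, hs, hroot⟩ := hex A hQA
      refine Finset.mem_image.2 ⟨(⟨s, hs⟩, A.image (BoxLabel.rot i (n i - s))),
        Finset.mem_product.2 ⟨Finset.mem_univ _, hmemTr.2 ⟨(hQ _ _).2 hQA, (rooted_image_rot_iff i _ m A).2 hroot⟩⟩, ?_⟩
      exact image_rot_image_rot_sub i hs.le A
    · intro hA
      obtain ⟨⟨s, A₀⟩, hx, rfl⟩ := Finset.mem_image.1 hA
      exact hmemT.2 ((hQ s.1 A₀).2 (hmemTr.1 (Finset.mem_product.1 hx).2).1)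
  -- the translations act freely on rooted `Q`-sets
  have hinj : Set.InjOn F ((Finset.univ ×ˢ Tr : Finset (Fin (n i) × Finset (BoxLabel n))) :
      Set (Fin (n i) × Finset (BoxLabel n))) := by
    rintro ⟨s, A₀⟩ hx ⟨s', A₀'⟩ hx' hxx'
    have hA₀ := hmemTr.1 (Finset.mem_product.1 (Finset.mem_coe.1 hx)).2
    have hA₀' := hmemTr.1 (Finset.mem_product.1 (Finset.mem_coe.1 hx')).2
    simp only [hF] at hxx'
    -- `A₀' = rot i r '' A₀` with `r = (s + nᵢ − s') mod nᵢ`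
    have hs := s.2
    have hs' := s'.2
    have hrel : A₀' = A₀.image (BoxLabel.rot i ((s : ℕ) + (n i - s'))) := by
      have h : (A₀.image (BoxLabel.rot i s)).image (BoxLabel.rot i (n i - s')) =
          (A₀'.image (BoxLabel.rot i s')).image (BoxLabel.rot i (n i - s')) := by rw [hxx']
      rw [image_rot_image_rot, image_rot_image_rot, Nat.sub_add_cancel hs'.le, image_rot_size] at h
      rw [← h, Nat.add_comm]
    -- reduce the shift below `nᵢ`
    obtain ⟨r, hr, hA₀'r⟩ : ∃ r, r < n i ∧ ((s : ℕ) + (n i - s')) % n i = r ∧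
        A₀' = A₀.image (BoxLabel.rot i r) := by
      by_cases hlt : (s : ℕ) + (n i - s') < n i
      · exact ⟨_, hlt, (Nat.mod_eq_of_lt hlt), hrel⟩
      · refine ⟨(s : ℕ) + (n i - s') - n i, by omega, ?_, ?_⟩
        · rw [show (s : ℕ) + (n i - s') = ((s : ℕ) + (n i - s') - n i) + n i by omega, Nat.add_mod_right,
            Nat.mod_eq_of_lt (by omega)]
          omega
        · rw [hrel, ← image_rot_add_size i ((s : ℕ) + (n i - s') - n i) A₀,
            Nat.sub_add_cancel (by omega : n i ≤ (s : ℕ) + (n i - s'))]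
    obtain ⟨hmod, hA₀'eq⟩ := hA₀'r
    -- freeness forces `r = 0`, i.e. `s = s'`
    have hroot' : (∀ p ∈ A₀, BoxLabel.coord i (BoxLabel.rot i r p) < m) ∧ ∃ p ∈ A₀, BoxLabel.coord i (BoxLabel.rot i r p) = 0 :=
      (rooted_image_rot_iff i r m A₀).1 (hA₀'eq ▸ hA₀'.2)
    have hr0 : r = 0 := hfree A₀ hA₀.1 hA₀.2.1 hA₀.2.2 r hr hroot'.1 hroot'.2
    have hss' : (s : ℕ) = s' := by
      rw [hr0] at hmod
      rcases Nat.lt_or_ge ((s : ℕ) + (n i - s')) (n i) with hlt | hge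
      · rw [Nat.mod_eq_of_lt hlt] at hmod; omega
      · rw [show (s : ℕ) + (n i - s') = ((s : ℕ) + (n i - s') - n i) + n i by omega, Nat.add_mod_right,
          Nat.mod_eq_of_lt (by omega)] at hmod
        omega
    have hseq : s = s' := Fin.ext hss'
    subst hseq
    exact Prod.ext rfl (image_rot_injective i s hxx')
  have hterm : ∀ x : Fin (n i) × Finset (BoxLabel n), ψ (F x) = ψ x.2 := fun x =>
    support_sum_image_rot_eq (G := G) hρ i x.1 x.2 z
  rw [himage, Finset.sum_image hinj, Finset.sum_product]
  simp only [hterm]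
  rw [Finset.sum_const, Finset.card_univ, Fintype.card_fin, nsmul_eq_mul]

/-! ## §4 Several directions: the factor `∏_{i ∈ J} nᵢ` -/

/-- **The factor of the volume for support sums (several directions)**, in a form robust to the spelling of the rooted family and to
decidability instances.  For a set `J` of directions and a property `Q` of label sets invariant under the translations in every direction
of `J`, rootable at scale `m` and with free action on rooted sets in every direction of `J` (as in `sum_support_eq_size_mul_sum_rooted`), and
any `Q'` equivalent to «`Q` and rooted at scale `m` in every direction of `J`»,
`Σ_{Q} ψ(z) = (∏_{i∈J} nᵢ) · Σ_{Q'} ψ(z)` for every complex `z`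
(induction on `J`: rootedness in direction `j` is invariant under the translations in the directions `i ≠ j`). -/
theorem sum_support_eq_prod_mul_sum_of_iff (hρ : Continuous ρ) (J : Finset (Fin d)) (m : ℕ)
    (Q : Finset (BoxLabel n) → Prop) [DecidablePred Q]
    (hQ : ∀ i ∈ J, ∀ (s : ℕ) (A : Finset (BoxLabel n)), Q (A.image (BoxLabel.rot i s)) ↔ Q A)
    (hex : ∀ i ∈ J, ∀ A, Q A → ∃ s, s < n i ∧ (∀ p ∈ A, BoxLabel.coord i (BoxLabel.rot i (n i - s) p) < m) ∧
      ∃ p ∈ A, BoxLabel.coord i (BoxLabel.rot i (n i - s) p) = 0)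
    (hfree : ∀ i ∈ J, ∀ A, Q A → (∀ p ∈ A, BoxLabel.coord i p < m) → (∃ p ∈ A, BoxLabel.coord i p = 0) →
      ∀ s, s < n i → (∀ p ∈ A, BoxLabel.coord i (BoxLabel.rot i s p) < m) →
        (∃ p ∈ A, BoxLabel.coord i (BoxLabel.rot i s p) = 0) → s = 0)
    (Q' : Finset (BoxLabel n) → Prop) [hdec : DecidablePred Q']
    (hQ' : ∀ A, Q' A ↔ Q A ∧ ∀ j ∈ J, (∀ p ∈ A, BoxLabel.coord j p < m) ∧ ∃ p ∈ A, BoxLabel.coord j p = 0)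
    (z : ℂ) :
    ∑ A ∈ (Finset.univ : Finset (BoxLabel n)).powerset with Q A,
        ∑ 𝒞 ∈ (rconnSubsets (boxSystem (G := G) ρ n).Adj A).powerset with 𝒞.biUnion id = A,
          truncatedWeight (GeomInc (boxSystem (G := G) ρ n).Adj)
            (connActivity (boxSystem (G := G) ρ n).Adj (zdHaar d G) ((boxSystem (G := G) ρ n).weight z)) 𝒞 =
      (∏ i ∈ J, (n i : ℂ)) * ∑ A ∈ (Finset.univ : Finset (BoxLabel n)).powerset with Q' A,
        ∑ 𝒞 ∈ (rconnSubsets (boxSystem (G := G) ρ n).Adj A).powerset with 𝒞.biUnion id = A,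
          truncatedWeight (GeomInc (boxSystem (G := G) ρ n).Adj)
            (connActivity (boxSystem (G := G) ρ n).Adj (zdHaar d G) ((boxSystem (G := G) ρ n).weight z)) 𝒞 := by
  set ψ : Finset (BoxLabel n) → ℂ := fun A =>
    ∑ 𝒞 ∈ (rconnSubsets (boxSystem (G := G) ρ n).Adj A).powerset with 𝒞.biUnion id = A,
      truncatedWeight (GeomInc (boxSystem (G := G) ρ n).Adj)
        (connActivity (boxSystem (G := G) ρ n).Adj (zdHaar d G) ((boxSystem (G := G) ρ n).weight z)) 𝒞 with hψ
  set R : Fin d → Finset (BoxLabel n) → Prop := fun j A =>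
    (∀ p ∈ A, BoxLabel.coord j p < m) ∧ ∃ p ∈ A, BoxLabel.coord j p = 0 with hR
  show ∑ A ∈ Finset.univ.powerset with Q A, ψ A = (∏ i ∈ J, (n i : ℂ)) * ∑ A ∈ Finset.univ.powerset with Q' A, ψ A
  induction J using Finset.induction_on generalizing Q' hdec with
  | empty =>
    rw [Finset.prod_empty, one_mul]
    exact Finset.sum_congr (Finset.filter_congr fun A _ => by rw [hQ']; simp) fun _ _ => rfl
  | @insert i J hiJ ih =>
    have hi : i ∈ insert i J := Finset.mem_insert_self i J
    -- the intermediate family: `Q` and rooted in the directions of `J`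
    set Q₁ : Finset (BoxLabel n) → Prop := fun A => Q A ∧ ∀ j ∈ J, R j A with hQ₁
    haveI hdec₁ : DecidablePred Q₁ := Classical.decPred _
    have h₁ := ih (fun i' hi' => hQ i' (Finset.mem_insert_of_mem hi')) (fun i' hi' => hex i' (Finset.mem_insert_of_mem hi'))
      (fun i' hi' => hfree i' (Finset.mem_insert_of_mem hi')) Q₁ (fun A => Iff.rfl)
    -- invariance of `Q₁` under the translations in direction `i ∉ J`
    have hQ₁rot : ∀ (s : ℕ) (A : Finset (BoxLabel n)), Q₁ (A.image (BoxLabel.rot i s)) ↔ Q₁ A := by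
      intro s A
      refine and_congr (hQ i hi s A) (forall₂_congr fun j hj => ?_)
      have hji : j ≠ i := fun h => hiJ (h ▸ hj)
      exact rooted_image_rot_iff_of_ne hji s m A
    -- one more rooting, in direction `i`
    have step := sum_support_eq_size_mul_sum_rooted (G := G) (ρ := ρ) hρ i m Q₁ hQ₁rot (fun A hA => hex i hi A hA.1)
      (fun A hA hlt h0 s hs hlt' h0' => hfree i hi A hA.1 hlt h0 s hs hlt' h0') z
    rw [h₁, Finset.prod_insert hiJ, mul_assoc, mul_comm ((n i : ℕ) : ℂ), mul_assoc]
    congr 1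
    rw [step, mul_comm]
    congr 1
    refine Finset.sum_congr (Finset.filter_congr fun A _ => ?_) fun _ _ => rfl
    rw [hQ']
    simp only [hQ₁, Finset.forall_mem_insert, hR]
    tauto

end Rotation

end Summit.QuantumFields.YangMills.Theorems.GlueballBandRecursion.SupportLifting

end
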